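import Summits.QuantumFields.YangMills.Theorems.ConvexGribovBodyNonSimplyConnectedLatticeGapChainChessboard
import Summits.QuantumFields.YangMills.Theorems.ConvexGribovBodyNonSimplyConnectedLatticeGapStubCruxOfMeanBoxInfluenceDecayHalfTorusNSC
import Summits.QuantumFields.YangMills.Theorems.ConvexGribovBodyNonSimplyConnectedLatticeGapStubHalfTorusLeafOfRareOfGoodMixing
import HarnessLib

/-!
# Crux `NonSimplyConnectedLatticeGap` (stmt-QuantumFields-16405), line `Sketch`: the crux REDUCED TO ITS OPEN CORE P2
# (weak mixing on cubes uniformly over good exterior data at large `β`, `π₁(G) ≠ 0`)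

Everything else of the line is in the tree: P1 `longBadChainsRare` (long bad chains are rare under the torus Wilson states at large
`β`), TR `stub_halfTorusLeaf_of_rare_of_goodMixing` (p134294: P1 ∧ P2 ⇒ the averaged leaf A‴ on cubes of diameter at most half the
torus) and T‴ `stub_cruxOfMeanBoxInfluenceDecayHalfTorusNSC` (p134093: A‴ ⇒ the crux, rate `m/2`). Hence

* `nonSimplyConnectedLatticeGap_of_goodExteriorMixing` — **P2 ⇒ `ConvexGribovBody.NonSimplyConnectedLatticeGap`**.

P2 (the hypothesis, verbatim the registered stub `stub_goodExteriorMixing` of the skeleton `Cruxes/NonSimplyConnectedLatticeGap/Lines/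
Sketch.lean`) says: for compact simple `G` with `π₁(G) ≠ 0` and a lattice representation `r` there is a badness threshold `a > 0` and
`β₂` such that for every `β ≥ β₂` there is `m > 0` with, for every gauge-invariant local observable `A` supported in the cube
`Λ_L = [−L,L]⁴ × univ`, the finite-volume Wilson expectations `γ_{Λ_L}(A | η)` for two GOOD exterior data `η, η'` (no long chain of
`a`-bad plaquettes in the shell `L < ‖x‖∞ ≤ 2L`, `Sketch.goodExterior`) differ by at most `C_A e^{−mL}`. It is the weak-coupling
mass-gap mechanism itself, freed of the obstruction that kills the sup-over-all-exterior-data form for these groups (forced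
`π₁(G)`-monopole world-lines, `Cruxes/NonSimplyConnectedLatticeGap/ForcedMonopoleLines.md`: a forced line is a long bad chain
crossing the shell, hence excluded by goodness, and rare by P1).
-/

set_option autoImplicit false

namespace Summit.QuantumFields.YangMills.Theorems.NonSimplyConnectedLatticeGap

/-- **The crux reduced to P2**: weak mixing on cubes uniformly over good exterior data at large `β` (hypothesis `hP2`, the
registered stub `stub_goodExteriorMixing` verbatim) implies `ConvexGribovBody.NonSimplyConnectedLatticeGap` (the volume-uniform
lattice mass gap at large `β` for compact simple `G` with `π₁(G) ≠ 0`), through P1 (`longBadChainsRare`, proved), TR (P1 ∧ P2 ⇒ the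
averaged half-torus leaf) and T‴ (leaf ⇒ crux). -/
theorem nonSimplyConnectedLatticeGap_of_goodExteriorMixing : (∀ (G : Type) [Group G] [TopologicalSpace G] [IsTopologicalGroup G] [CompactSpace G] [MeasurableSpace G] [BorelSpace G], Literature.MathematicalPhysics.QuantumFieldTheory.IsCompactSimpleLieGroup G → ¬ SimplyConnectedSpace G → ∀ r : Literature.MathematicalPhysics.QuantumFieldTheory.LatticeRep G, ∃ a : ℝ, 0 < a ∧ ∃ β₂ : ℝ, ∀ β : ℝ, β₂ ≤ β → ∃ m : ℝ, 0 < m ∧ ∀ A : Literature.MathematicalPhysics.QuantumFieldTheory.YMSpecies G, ∃ C : ℝ, ∀ L : ℕ, A.supp ⊆ ((Fintype.piFinset fun _ : Fin 4 => Finset.Icc (-((L : ℕ) : ℤ)) ((L : ℕ) : ℤ)) ×ˢ (Finset.univ : Finset (Fin 4))) → ∀ η ∈ Summit.QuantumFields.YangMills.Cruxes.NonSimplyConnectedLatticeGap.Sketch.goodExterior r.ρ a L, ∀ η' ∈ Summit.QuantumFields.YangMills.Cruxes.NonSimplyConnectedLatticeGap.Sketch.goodExterior r.ρ a L, |(∫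 U, A.F U ∂(Literature.MathematicalPhysics.QuantumLattice.ymSpecification r.ρ β ((Fintype.piFinset fun _ : Fin 4 => Finset.Icc (-((L : ℕ) : ℤ)) ((L : ℕ) : ℤ)) ×ˢ (Finset.univ : Finset (Fin 4))) η)) - ∫ U, A.F U ∂(Literature.MathematicalPhysics.QuantumLattice.ymSpecification r.ρ β ((Fintype.piFinset fun _ : Fin 4 => Finset.Icc (-((L : ℕ) : ℤ)) ((L : ℕ) : ℤ)) ×ˢ (Finset.univ : Finset (Fin 4))) η')| ≤ C * Real.exp (-(m * L))) → Summit.QuantumFields.YangMills.Theses.ConvexGribovBody.NonSimplyConnectedLatticeGap :=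
  fun hP2 => stub_cruxOfMeanBoxInfluenceDecayHalfTorusNSC (stub_halfTorusLeaf_of_rare_of_goodMixing longBadChainsRare hP2)

end Summit.QuantumFields.YangMills.Theorems.NonSimplyConnectedLatticeGap
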